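import Mathlib
import Summits.HubbardSuperconductivity.HubbardSuperconductivity.Theorems.NodalWardXYVisonPairCostDefs

/-!
# Glue of the line `Sketch` (log-determinant transfer) for the crux `NodalWardXY.VisonPairCost`
# (stmt-HubbardSuperconductivity-1266): stub `stub_glue`

Pure bookkeeping/calculus composing the five analytic statements of the line (vocabulary file
`Theorems/NodalWardXYVisonPairCostDefs.lean`) into the body `CruxBound` of the crux:

* `GroundEnergyFormula` at `R` and at `0`: `E_R − E_0 = −(S_R − S_0)/2`, `S = Σᵢ|λᵢ(visonNambu)|`;
* `LogDetFormula`: `S_R − S_0 = (2/π) ∫_{(0,∞)} K`, `K = logDetKernel N_R N_0` integrable on `(0,∞)`,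
  so `|E_R − E_0| = (1/π) |∫_{(0,∞)} K|`;
* split `(0,∞) = (0,a] ∪ (a,t₀] ∪ (t₀,∞)` with `a = 1/L ≤ 1/4 < 1 ≤ t₀`:
  the tail is `≤ ∫_{(t₀,∞)} C₃/t² = C₃/t₀` (`Ultraviolet`), the middle piece is
  `≤ C₅ − a|K a|` (`InfraredWindow`), and the small-`t` piece is
  `∫_{(0,a]} (K t − K a) dt + a K a` with `|∫_{(0,a]} (K t − K a)| ≤ ∫₀^a 8R log(a/t) dt = 8R a = 8R/L ≤ 4`
  (`RankWindow`, `2R ≤ L`, `∫₀^a log = a log a − a`).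

The constant is `C = (1/π)(4 + C₅ + C₃/t₀)`, independent of `L` and `R`.  The matrix objects
`visonH`, `visonNambu`, `logDetKernel` stay opaque throughout; the analysis is the Mathlib-only lemma
`abs_setIntegral_Ioi_le_of_windows` about a real function on `(0,∞)`.  No definition is introduced.
-/

noncomputable section

-- tree namespace Summit.HubbardSuperconductivity.HubbardSuperconductivity (D-0017)
set_option linter.dupNamespace false

namespace Summit.HubbardSuperconductivity.HubbardSuperconductivity.Theorems.VisonPairCost

open MeasureTheory Set
open Literature.Probability.LatticeModels Literature.MathematicalPhysics.QuantumLattice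

/-- **Three-window bound.** If `K` is integrable on `(0,∞)`, `|K t| ≤ C₃/t²` for `t ≥ t₀`,
`|K t − K a| ≤ 8R log(a/t)` for `0 < t ≤ a`, `∫_{(a,t₀]} |K| + a|K a| ≤ C₅`, `0 < a ≤ t₀` and
`8Ra ≤ 4`, then `|∫_{(0,∞)} K| ≤ 4 + C₅ + C₃/t₀`: split `(0,∞) = (0,a] ∪ (a,t₀] ∪ (t₀,∞)`,
`∫_{(t₀,∞)} t⁻² = 1/t₀`, and `∫_{(0,a]} (log a − log t) dt = a`. [folklore] -/
private theorem abs_setIntegral_Ioi_le_of_windows {K : ℝ → ℝ} {a t₀ C₃ C₅ R : ℝ} (ha0 : 0 < a)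
    (hat : a ≤ t₀) (hint : IntegrableOn K (Ioi 0))
    (hUV : ∀ t, t₀ ≤ t → |K t| ≤ C₃ / t ^ 2)
    (hRW : ∀ t, 0 < t → t ≤ a → |K t - K a| ≤ 8 * R * Real.log (a / t))
    (hIR : (∫ t in Ioc a t₀, |K t|) + a * |K a| ≤ C₅) (hRa : 8 * R * a ≤ 4) :
    |∫ t in Ioi 0, K t| ≤ 4 + C₅ + C₃ / t₀ := by
  have ht₀ : 0 < t₀ := ha0.trans_le hat
  -- integrability on the pieces
  have hI1 : IntegrableOn K (Ioc 0 a) := hint.mono_set Ioc_subset_Ioi_self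
  have hI12 : IntegrableOn K (Ioc 0 t₀) := hint.mono_set Ioc_subset_Ioi_self
  have hI2 : IntegrableOn K (Ioc a t₀) :=
    hint.mono_set (Ioc_subset_Ioi_self.trans (Ioi_subset_Ioi ha0.le))
  have hI3 : IntegrableOn K (Ioi t₀) := hint.mono_set (Ioi_subset_Ioi ht₀.le)
  -- splitting `(0,∞) = (0,a] ∪ (a,t₀] ∪ (t₀,∞)`
  have hsplit : ∫ t in Ioi 0, K t =
      (∫ t in Ioc 0 a, K t) + (∫ t in Ioc a t₀, K t) + ∫ t in Ioi t₀, K t := by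
    have h1 := setIntegral_union (Ioc_disjoint_Ioi_same (a := (0 : ℝ)) (b := t₀)) measurableSet_Ioi
      hI12 hI3
    have h2 := setIntegral_union (Ioc_disjoint_Ioc_of_le (a := (0 : ℝ)) (d := t₀) (le_refl a))
      measurableSet_Ioc hI1 hI2
    rw [Ioc_union_Ioi_eq_Ioi ht₀.le] at h1
    rw [Ioc_union_Ioc_eq_Ioc ha0.le hat] at h2
    rw [h1, h2]
  -- the ultraviolet tail `(t₀,∞)`
  have htail : |∫ t in Ioi t₀, K t| ≤ C₃ / t₀ := by
    have hpow : IntegrableOn (fun t : ℝ => C₃ * t ^ (-2 : ℝ)) (Ioi t₀) :=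
      (integrableOn_Ioi_rpow_of_lt (by norm_num) ht₀).const_mul C₃
    calc |∫ t in Ioi t₀, K t| ≤ ∫ t in Ioi t₀, |K t| := abs_integral_le_integral_abs
      _ ≤ ∫ t in Ioi t₀, C₃ * t ^ (-2 : ℝ) := by
          refine setIntegral_mono_on hI3.abs hpow measurableSet_Ioi fun t ht => ?_
          have ht' : 0 < t := ht₀.trans ht
          have h := hUV t (le_of_lt ht)
          simp only [div_eq_mul_inv] at h
          simpa only [Real.rpow_neg ht'.le, Real.rpow_two] using h
      _ = C₃ / t₀ := by
          rw [integral_const_mul, integral_Ioi_rpow_of_lt (by norm_num) ht₀,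
            show (-2 : ℝ) + 1 = -1 by norm_num, Real.rpow_neg_one]
          ring
  -- the infrared window `(a,t₀]`
  have hmid : |∫ t in Ioc a t₀, K t| ≤ C₅ - a * |K a| := by
    have := abs_integral_le_integral_abs (f := K) (μ := volume.restrict (Ioc a t₀))
    linarith
  -- the rank window `(0,a]`
  have hsmall : |∫ t in Ioc 0 a, K t| ≤ 4 + a * |K a| := by
    have hc : IntegrableOn (fun _ : ℝ => K a) (Ioc 0 a) := integrableOn_const measure_Ioc_lt_top.ne
    have hconst : ∫ _ in Ioc 0 a, K a = a * K a := by
      rw [setIntegral_const, Real.volume_real_Ioc_of_le ha0.le, sub_zero, smul_eq_mul]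
    have hdecomp : ∫ t in Ioc 0 a, K t = (∫ t in Ioc 0 a, (K t - K a)) + a * K a := by
      have := integral_sub hI1 hc
      rw [hconst] at this
      linarith
    have hgi : IntervalIntegrable (fun t => 8 * R * (Real.log a - Real.log t)) volume 0 a :=
      ((intervalIntegrable_const (c := Real.log a)).sub
        intervalIntegral.intervalIntegrable_log').const_mul (8 * R)
    have hg : IntegrableOn (fun t => 8 * R * (Real.log a - Real.log t)) (Ioc 0 a) :=
      (intervalIntegrable_iff_integrableOn_Ioc_of_le ha0.le).mp hgi
    have hgint : ∫ t in Ioc 0 a, 8 * R * (Real.log a - Real.log t) = 8 * R * a := by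
      rw [← intervalIntegral.integral_of_le ha0.le, intervalIntegral.integral_const_mul,
        intervalIntegral.integral_sub (intervalIntegrable_const (c := Real.log a))
          intervalIntegral.intervalIntegrable_log',
        intervalIntegral.integral_const, integral_log_from_zero]
      simp only [sub_zero, smul_eq_mul]
      ring
    have hb : |∫ t in Ioc 0 a, (K t - K a)| ≤ 8 * R * a := by
      calc |∫ t in Ioc 0 a, (K t - K a)| ≤ ∫ t in Ioc 0 a, |K t - K a| :=
            abs_integral_le_integral_abs
        _ ≤ ∫ t in Ioc 0 a, 8 * R * (Real.log a - Real.log t) := by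
            refine setIntegral_mono_on (hI1.sub' hc).abs hg measurableSet_Ioc fun t ht => ?_
            have h := hRW t ht.1 ht.2
            rwa [Real.log_div ha0.ne' ht.1.ne'] at h
        _ = 8 * R * a := hgint
    have h1 := abs_add_le (∫ t in Ioc 0 a, (K t - K a)) (a * K a)
    rw [← hdecomp, abs_mul, abs_of_pos ha0] at h1
    linarith
  -- sum of the three windows
  rw [hsplit]
  have h1 := abs_add_le ((∫ t in Ioc 0 a, K t) + ∫ t in Ioc a t₀, K t) (∫ t in Ioi t₀, K t)
  have h2 := abs_add_le (∫ t in Ioc 0 a, K t) (∫ t in Ioc a t₀, K t)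
  linarith

/-- **Glue of the line `Sketch`**: the BdG ground-energy formula, the Matsubara log-determinant
formula, the ultraviolet bound, the rank window and the infrared window together give the uniform
bound `|E₀(visonH R) − E₀(visonH 0)| ≤ (1/π)(4 + C₅(μ,Δ₀,t₀) + C₃(μ,Δ₀)/t₀)` for `L ≥ 4`, `2R ≤ L`,
i.e. `CruxBound`. [folklore] -/
theorem stub_glue : GroundEnergyFormula → LogDetFormula → Ultraviolet → RankWindow → InfraredWindow →
    CruxBound := by
  intro hGE hLD hUV hRW hIR μ hμ hμ0 Δ₀ hΔ₀
  obtain ⟨t₀, C₃, ht₀, hUV'⟩ := hUV μ Δ₀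
  obtain ⟨C₅, hIR'⟩ := hIR μ hμ hμ0 Δ₀ hΔ₀ t₀ ht₀
  refine ⟨1 / Real.pi * (4 + C₅ + C₃ / t₀), fun L _ hL R hR => ?_⟩
  obtain ⟨hA, hEA⟩ := hGE L hL μ Δ₀ R
  obtain ⟨hB, hEB⟩ := hGE L hL μ Δ₀ 0
  obtain ⟨hint, hS⟩ := hLD (Orb (FermionTorus 2 L)) (visonNambu L μ Δ₀ R) (visonNambu L μ Δ₀ 0) hA hB
  have hL4 : (4 : ℝ) ≤ L := by exact_mod_cast hL
  have hL0 : (0 : ℝ) < L := by linarith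
  have ha0 : 0 < 1 / (L : ℝ) := by positivity
  have hat : 1 / (L : ℝ) ≤ t₀ := by
    rw [div_le_iff₀ hL0]
    nlinarith
  have hRa : 8 * (R : ℝ) * (1 / (L : ℝ)) ≤ 4 := by
    have hR' : (2 * R : ℝ) ≤ L := by exact_mod_cast hR
    rw [← mul_div_assoc, mul_one, div_le_iff₀ hL0]
    linarith
  have hmain := abs_setIntegral_Ioi_le_of_windows ha0 hat hint (hUV' L hL R hR)
    (hRW L hL μ Δ₀ R (1 / (L : ℝ))) (hIR' L hL R hR) hRa
  have hE : (visonH L μ Δ₀ R).groundEnergy - (visonH L μ Δ₀ 0).groundEnergy =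
      -(1 / Real.pi) *
        ∫ t in Ioi (0 : ℝ), logDetKernel (visonNambu L μ Δ₀ R) (visonNambu L μ Δ₀ 0) t := by
    rw [hEA, hEB]
    linear_combination (-1 / 2 : ℝ) * hS
  rw [hE, abs_mul, abs_neg, abs_of_pos (by positivity : (0 : ℝ) < 1 / Real.pi)]
  exact mul_le_mul_of_nonneg_left hmain (by positivity)

end Summit.HubbardSuperconductivity.HubbardSuperconductivity.Theorems.VisonPairCost

end
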